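import Literature.AnabelianGeometry.EtaleTheta.SettingModelChiMuTwo
import Literature.AnabelianGeometry.EtaleTheta.SettingModelChiAnchoredPoints
import Literature.AnabelianGeometry.EtaleTheta.SettingModelChiProp15ii
import Literature.AnabelianGeometry.EtaleTheta.SettingModelChiProp15iiiSplitNegative
import Literature.AnabelianGeometry.EtaleTheta.SettingModelChiDoubleUnderline
import Literature.AnabelianGeometry.EtaleTheta.Discharge.Sec2ThetaOrbitClasses
import HarnessLib

/-!
# [EtTh] Def. 1.9 at the χ-model: THE `η̈^{Θ,Z}`-ORBIT LEMMA for `MuTwoSetting.modelχ` (`ε_Z := a`) — a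
# `conj_a`-fixed class has a singleton orbit and singleton sets of values (PROOF-ONLY)

S. Mochizuki, *The étale theta function and its Frobenioid-theoretic manifestations*, Publ. RIMS **45** (2009)
[EtTh], §1, Def. 1.9 p. 29 ("write `η̈^{Θ,Z}` for the `Π^tp_Ẋ/Π^tp_Ÿ ≅ Z`-orbit of `η̈^Θ`"; "`η̈^{Θ,Z}|_τ`,
`η̈^{Θ,Z}|_{τ⁻¹}`"), Rmk. 1.9.1, Prop. 1.5 (ii)/(iii) p. 23 [cite: MochizukiEtTh2009, Def 1.9 p.29]. Layer L2 of
the abc-iut cell, block F tranche 113 (seat abc-iut-f-113 gen 3), R78 cluster hand F8 step 2a. PROOF-ONLY over this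
seat's `SettingModelChiMuTwo` (F8, p439036: `MuTwoSetting.modelχ`, `parityχ`/`Xddχ`, `epsZχ := a`,
`toZ_inl_gfpOf_zero`, `mul_self_mem_Xddχ`), abc-iut-L2-t6's `SettingModelChiSectionPoints` /
`SettingModelChiAnchoredPoints` (F7b: `kummerDataχSec`, `mem_GtpYdd_modelχ_iff`, `anchoredPointχ`), abc-iut-L6-d5 /
L2-t12's `SettingModelChiProp15ii` (`prop15ii_kummerDataχSec`), abc-iut-L2-t12's `SettingModelChiProp15iiiSplitNegative`
(`conj_genA_logUddχ`: the pure deck generator FIXES `log(Ü)` on `(Π^tp_Ÿ)^Θ`), abc-iut-L2-d1's `levelHom_x_eq_cast`,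
abc-iut-L6-t12's `ContH1.conj_*_apply` / `ContH1.infl_conj`, abc-iut-L2-t1's `ContH1.conj_eq_self_of_mem`,
abc-iut-w5-d234's `MuTwoSetting.conj_inflTheta_kumYdd_eq_self` — all consumed BY NAME; no `def`, no instance.

RESULTS. (A) **bookkeeping** `Π^tp_Ẋ ∩ Π^tp_X = Π^tp_Ÿ · ⟨a⟩` at the χ-model (`K = K̈ = K₂ = J̈₁ = ℚ_p`):
`exists_eq_mul_zpow_of_mem_Xddχ` (every element of `Π^tp_Ẍ` is `y·(a·a)^e`, `y ∈ Π^tp_Ÿ` — its degree is even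
by the `a`-parity), `exists_eq_mul_zpow_of_inclX_mem_dotX` (`inclX σ ∈ Π^tp_Ẋ ⇒ σ = y·a^k`); (A′) **the orbit
lemma** `thetaOrbit_modelχ_eq_singleton` (`conj_a x = x ⇒ η̈^{Θ,Z}(x) = {x}`: inner automorphisms of `Π^tp_Ÿ`
act trivially) and `valuesAt_eq_singleton_of_thetaOrbit_eq` (singleton orbit ⇒ `valuesAt x y₀ = {value}`,
generic over any `MuTwoSetting`); (B) **the test class** `η̈_c := infl κ̈(c) · infl log(Ü)` over L2-t6's section
datum: `conj_genA_inflTheta_logUdd` (L2-t12's theta-quotient statement inflated), `conj_inflTheta_kumYdd_modelχ`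
(EVERY `σ` fixes `infl κ̈(c)`: Prop. 1.5 (ii) holds at the section datum), `thetaOrbit_testClass` (singleton orbit)
and `evalAt_testClass` (its value at an anchored section-point of parameter `w` is `c·w`). Used by the sequel
`Discharge/Sec1Thm110ClosuresModelChi.lean` (the ∀-closure tests of F-0512/F-0513/F-0514).

HONEST FRAMING: SEMI-SYNTHETIC model (stage 1, split: the deck generator acts trivially on `log(Ü)`, which is
exactly why Prop. 1.5 (iii) FAILS there — abc-iut-L2-t12); consistency/decision evidence for OUR typed interface only;
nothing of [EtTh] is asserted; typed ≠ proved; no side is taken on [IUTchIII] Cor. 3.12.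
-/

noncomputable section

namespace Literature.AnabelianGeometry.EtaleTheta.SettingModel

open Literature.AnabelianGeometry.SemiGraphs _root_.Function

variable (p : ℕ) [Fact p.Prime]

/-! ### (A) Degree/parity bookkeeping: `Π^tp_Ẋ ∩ Π^tp_X = Π^tp_Ÿ · ⟨a⟩` at the χ-model -/

/-- An element of `Π^tp_X` of degree `0` whose `Γ`-part has even parities lies in `Π^tp_Ÿ` (`K = K̈ = K₂ = J̈₁ =
ℚ_p` at the χ-model). [cite: MochizukiEtTh2009, §1 p.17] -/
theorem mem_gtpYdd_modelχ_of_mem_Xddχ_of_toZ {g : PiTpχ p} (hg : g ∈ Xddχ p)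
    (hdeg : (ThetaSetting.modelχ p).toZ g = 1) : g ∈ (ThetaSetting.modelχ p).GtpYdd := by
  refine (mem_GtpYdd_modelχ_iff p g).2 ⟨?_, ?_⟩
  · refine ((chiTwistData p).mem_YN).2 ⟨Subgroup.mem_inf.2 ⟨?_, ?_⟩, ?_⟩
    · exact hdeg
    · have h := (mem_Xddχ_iff p g).1 hg
      have h2 : (2 * 1 : ℕ+) = 2 := rfl
      rw [h2]
      exact (mem_dXdd_iff g.left).1 h
    · rw [fieldKN_bot_qModel_two_mul_one, IntermediateField.fixingSubgroup_bot]
      exact Subgroup.mem_top _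
  · rw [fieldJddN_bot_qModel_one, IntermediateField.fixingSubgroup_bot]
    exact Subgroup.mem_top _

/-- The degree of an element of `Π^tp_Ẍ` is EVEN (its `a`-parity vanishes). [cite: MochizukiEtTh2009, Def 1.7 p.27] -/
theorem two_dvd_toZ_of_mem_Xddχ {g : PiTpχ p} (hg : g ∈ Xddχ p) :
    (2 : ℤ) ∣ Multiplicative.toAdd ((ThetaSetting.modelχ p).toZ g) := by
  have hx : (levelHom 2 g.left).x = 0 := ((mem_dXdd_iff g.left).1 ((mem_Xddχ_iff p g).1 hg)).1
  rw [levelHom_x_eq_cast] at hx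
  exact (ZMod.intCast_zmod_eq_zero_iff_dvd _ 2).1 hx

/-- **Decomposition of `Π^tp_Ẍ`**: every `g ∈ Π^tp_Ẍ` is `y · (a·a)^e` with `y ∈ Π^tp_Ÿ`.
[cite: MochizukiEtTh2009, Def 1.7 p.27] -/
theorem exists_eq_mul_zpow_of_mem_Xddχ {g : PiTpχ p} (hg : g ∈ Xddχ p) :
    ∃ y ∈ (ThetaSetting.modelχ p).GtpYdd, ∃ e : ℤ,
      g = y * ((SemidirectProduct.inl (gfpOf (FreeGroup.of 0)) : PiTpχ p) *
        SemidirectProduct.inl (gfpOf (FreeGroup.of 0))) ^ e := by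
  obtain ⟨e, he⟩ := two_dvd_toZ_of_mem_Xddχ p hg
  set a₀ : PiTpχ p := SemidirectProduct.inl (gfpOf (FreeGroup.of 0)) with ha₀
  refine ⟨g * ((a₀ * a₀) ^ e)⁻¹, ?_, e, by rw [inv_mul_cancel_right]⟩
  refine mem_gtpYdd_modelχ_of_mem_Xddχ_of_toZ p ?_ ?_
  · exact (Xddχ p).mul_mem hg ((Xddχ p).inv_mem ((Xddχ p).zpow_mem (mul_self_mem_Xddχ p a₀) e))
  · have ha : (ThetaSetting.modelχ p).toZ a₀ = Multiplicative.ofAdd 1 := toZ_inl_gfpOf_zero p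
    rw [map_mul, map_inv, map_zpow, map_mul, ha]
    apply Multiplicative.toAdd.injective
    rw [toAdd_mul, toAdd_inv, toAdd_zpow, toAdd_mul, toAdd_ofAdd, he, toAdd_one]
    ring

/-- **`inclX σ ∈ Π^tp_Ẋ` (for `ε_Z := a`) forces `σ = y · a^k` with `y ∈ Π^tp_Ÿ`** — the group theory behind «the
`Π^tp_Ẋ/Π^tp_Ÿ ≅ Z`-orbit» at the χ-model. [cite: MochizukiEtTh2009, Def 1.9 p.29] -/
theorem exists_eq_mul_zpow_of_inclX_mem_dotX {σ : PiTpχ p}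
    (hσ : inclXχ p σ ∈ (MuTwoSetting.modelχ p).dotX (epsZχ p)) :
    ∃ y ∈ (ThetaSetting.modelχ p).GtpYdd, ∃ k : ℤ,
      σ = y * (SemidirectProduct.inl (gfpOf (FreeGroup.of 0)) : PiTpχ p) ^ k := by
  set a₀ : PiTpχ p := SemidirectProduct.inl (gfpOf (FreeGroup.of 0)) with ha₀
  haveI : ((Xddχ p).map (inclXχ p)).Normal := (MuTwoSetting.modelχ p).map_GtpXdd_normal
  have hmem : inclXχ p σ ∈ (((Xddχ p).map (inclXχ p) ⊔ Subgroup.zpowers (epsZχ p) : Subgroup (PiCprodχ p)) :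
      Set (PiCprodχ p)) := hσ
  rw [Subgroup.normal_mul] at hmem
  obtain ⟨n, hn, h, hh, hnh⟩ := Set.mem_mul.1 hmem
  obtain ⟨x, hx, rfl⟩ := Subgroup.mem_map.1 hn
  obtain ⟨k, rfl⟩ := Subgroup.mem_zpowers_iff.1 hh
  have hσ' : σ = x * a₀ ^ k := by
    apply (MuTwoSetting.modelχ p).injective_inclX
    change inclXχ p σ = inclXχ p (x * a₀ ^ k)
    rw [map_mul, map_zpow, hnh.symm]
    rfl
  obtain ⟨y, hy, e, rfl⟩ := exists_eq_mul_zpow_of_mem_Xddχ p hx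
  refine ⟨y, hy, 2 * e + k, ?_⟩
  rw [hσ', zpow_add, zpow_mul, mul_assoc]
  congr 2
  rw [zpow_ofNat, pow_two]

/-! ### (A′) The orbit lemma: a `conj_a`-fixed class has a singleton `η̈^{Θ,Z}`-orbit and singleton value sets -/

/-- If `conj_σ x = x` then `conj_{σ^n} x = x` for every `n ∈ ℤ`. [cite: NeukirchSchmidtWingberg2008, I §5] -/
theorem conj_zpow_eq_self_of_conj_eq_self (hC : (ThetaSetting.modelχ p).Compat) {σ : PiTpχ p}
    {x : (ThetaSetting.modelχ p).H1 (ThetaSetting.modelχ p).GtpYdd}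
    (h : haveI := hC.GtpYdd_normal
      ContH1.conj (ThetaSetting.modelχ p).toTheta (ThetaSetting.modelχ p).DeltaTheta σ x = x) (n : ℤ) :
    haveI := hC.GtpYdd_normal
    ContH1.conj (ThetaSetting.modelχ p).toTheta (ThetaSetting.modelχ p).DeltaTheta (σ ^ n) x = x := by
  haveI := hC.GtpYdd_normal
  induction n using Int.induction_on with
  | zero => rw [zpow_zero, ContH1.conj_one_apply]
  | succ n ih => rw [zpow_add_one, ContH1.conj_mul_apply, h, ih]
  | pred n ih =>
    rw [zpow_sub_one, ContH1.conj_mul_apply]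
    have h' : ContH1.conj (ThetaSetting.modelχ p).toTheta (ThetaSetting.modelχ p).DeltaTheta σ⁻¹ x = x := by
      conv_lhs => rw [← h]
      rw [ContH1.conj_inv_conj_apply]
    rw [h', ih]

/-- **THE ORBIT LEMMA at the χ-model** (`ε_Z := a`): a class `x ∈ H¹(Π^tp_Ÿ, Δ_Θ)` fixed by the deck generator
`a` has `η̈^{Θ,Z}`-orbit `{x}` — every `σ ∈ Π^tp_X` with `inclX σ ∈ Π^tp_Ẋ` is `y·a^k`, `y ∈ Π^tp_Ÿ` acting
innerly (abc-iut-L2-t1's `ContH1.conj_eq_self_of_mem`). [cite: MochizukiEtTh2009, Def 1.9 p.29] -/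
theorem thetaOrbit_modelχ_eq_singleton (hC : (ThetaSetting.modelχ p).Compat)
    {x : (ThetaSetting.modelχ p).H1 (ThetaSetting.modelχ p).GtpYdd}
    (hx : haveI := hC.GtpYdd_normal
      ContH1.conj (ThetaSetting.modelχ p).toTheta (ThetaSetting.modelχ p).DeltaTheta
        (SemidirectProduct.inl (gfpOf (FreeGroup.of 0)) : PiTpχ p) x = x) :
    (MuTwoSetting.modelχ p).thetaOrbit hC (epsZχ p) x = {x} := by
  haveI := hC.GtpYdd_normal
  ext y
  constructor
  · rintro ⟨σ, hσ, rfl⟩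
    obtain ⟨y, hy, k, rfl⟩ := exists_eq_mul_zpow_of_inclX_mem_dotX p hσ
    rw [Set.mem_singleton_iff]
    change ContH1.conj (ThetaSetting.modelχ p).toTheta (ThetaSetting.modelχ p).DeltaTheta
      (y * (SemidirectProduct.inl (gfpOf (FreeGroup.of 0)) : PiTpχ p) ^ k) x = x
    rw [ContH1.conj_mul_apply, conj_zpow_eq_self_of_conj_eq_self p hC hx k, ContH1.conj_eq_self_of_mem y hy]
  · intro hy
    rw [Set.mem_singleton_iff] at hy
    subst hy
    refine ⟨1, Subgroup.one_mem _ |> fun h => by rw [map_one]; exact h, ?_⟩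
    change y = ContH1.conj (ThetaSetting.modelχ p).toTheta (ThetaSetting.modelχ p).DeltaTheta 1 y
    rw [ContH1.conj_one_apply]

/-- **Singleton orbit ⇒ singleton set of values**: if `η̈^{Θ,Z} = {x}` and `x|_{y₀}` evaluates to `v₀`, then
`valuesAt x y₀ = {v₀}` (`K̈^× ↪ (K̈^×)^∧`). [cite: MochizukiEtTh2009, Def 1.9 (i) p.29] -/
theorem valuesAt_eq_singleton_of_thetaOrbit_eq {M : MuTwoSetting p} (hC : M.toThetaSetting.Compat) (εZ : M.GtpC)
    {E : M.toThetaSetting.KummerData} {x : M.toThetaSetting.H1 M.toThetaSetting.GtpYdd}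
    (horb : M.thetaOrbit hC εZ x = {x}) (y₀ : ThetaSetting.NonCuspidalPoint E) {v₀ : (↥M.Kdd)ˣ}
    (hv : y₀.evalAt (ContH1.res M.toTheta M.toThetaSetting.DeltaTheta y₀.Dpt_le x) = E.toKddHat v₀) :
    MuTwoSetting.valuesAt hC εZ x y₀ = {v₀} := by
  ext v
  constructor
  · rintro ⟨y, hy, hyv⟩
    rw [horb, Set.mem_singleton_iff] at hy
    subst hy
    exact Set.mem_singleton_iff.2 (E.toKddHat_injective (hyv.symm.trans hv))
  · intro hv'
    rw [Set.mem_singleton_iff] at hv'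
    subst hv'
    exact ⟨x, by rw [horb]; exact Set.mem_singleton _, hv⟩

/-! ### (B) The test class `η̈ := infl κ̈(c) · infl log(Ü)` is fixed by the deck generator `a` -/

/-- **`conj_a` fixes `infl log(Ü)`** in `H¹(Π^tp_Ÿ, Δ_Θ)` at the χ-model: abc-iut-L2-t12's `conj_genA_logUddχ`
(on `(Π^tp_Ÿ)^Θ`) transported by `ContH1.infl_conj`. [cite: MochizukiEtTh2009, Prop 1.5 (iii) p.23] -/
theorem conj_genA_inflTheta_logUdd (hC : (ThetaSetting.modelχ p).Compat) :
    haveI := hC.GtpYdd_normal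
    ContH1.conj (ThetaSetting.modelχ p).toTheta (ThetaSetting.modelχ p).DeltaTheta
        (SemidirectProduct.inl (gfpOf (FreeGroup.of 0)) : PiTpχ p)
        ((ThetaSetting.modelχ p).inflTheta (ThetaSetting.modelχ p).GtpYdd (kummerDataχSec p).logUdd) =
      (ThetaSetting.modelχ p).inflTheta (ThetaSetting.modelχ p).GtpYdd (kummerDataχSec p).logUdd := by
  haveI := hC.GtpYdd_normal
  haveI := hC.GtpYddTheta_normal
  have h := conj_genA_logUddχ p hC
  rw [kummerDataχSec_logUdd]
  change ContH1.conj _ _ _ (ContH1.infl (ThetaSetting.modelχ p).DeltaTheta (ThetaSetting.modelχ p).toTheta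
      (ThetaSetting.modelχ p).continuous_toTheta le_rfl (logUddχ p)) =
    ContH1.infl (ThetaSetting.modelχ p).DeltaTheta (ThetaSetting.modelχ p).toTheta
      (ThetaSetting.modelχ p).continuous_toTheta le_rfl (logUddχ p)
  rw [← ContH1.infl_conj (H₀ := (ThetaSetting.modelχ p).GtpYdd)
    (H' := (ThetaSetting.modelχ p).GtpYdd.map (ThetaSetting.modelχ p).toTheta)
    (hψ := (ThetaSetting.modelχ p).continuous_toTheta) le_rfl]
  exact congrArg _ h

/-- **Every `σ ∈ Π^tp_X` fixes the inflated Kummer classes `infl κ̈(c)`** of the section datum (Prop. 1.5 (ii) holds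
there: `F̈² = Im κ̈`, abc-iut-L6-d5/L2-t12 `prop15ii_kummerDataχSec`; then abc-iut-w5-d234's
`MuTwoSetting.conj_inflTheta_kumYdd_eq_self`). [cite: MochizukiEtTh2009, Prop 1.5 (ii) p.23] -/
theorem conj_inflTheta_kumYdd_modelχ (hC : (ThetaSetting.modelχ p).Compat) (σ : PiTpχ p)
    (c : (↥(ThetaSetting.modelχ p).Kdd)ˣ) :
    haveI := hC.GtpYdd_normal
    ContH1.conj (ThetaSetting.modelχ p).toTheta (ThetaSetting.modelχ p).DeltaTheta σ
        ((ThetaSetting.modelχ p).inflTheta (ThetaSetting.modelχ p).GtpYdd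
          ((kummerDataχSec p).kumYdd ((kummerDataχSec p).toKddHat c))) =
      (ThetaSetting.modelχ p).inflTheta (ThetaSetting.modelχ p).GtpYdd
        ((kummerDataχSec p).kumYdd ((kummerDataχSec p).toKddHat c)) :=
  (MuTwoSetting.modelχ p).conj_inflTheta_kumYdd_eq_self hC (kummerDataχSec p) σ c
    (by rw [(prop15ii_kummerDataχSec p hC).Fdd2_eq]; exact ⟨_, rfl⟩)

/-- **The test class** `η̈_c := infl κ̈(c) · infl log(Ü)` is fixed by `conj_a`. [cite: MochizukiEtTh2009, Def 1.9 p.29] -/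
theorem conj_genA_testClass (hC : (ThetaSetting.modelχ p).Compat) (c : (↥(ThetaSetting.modelχ p).Kdd)ˣ) :
    haveI := hC.GtpYdd_normal
    ContH1.conj (ThetaSetting.modelχ p).toTheta (ThetaSetting.modelχ p).DeltaTheta
        (SemidirectProduct.inl (gfpOf (FreeGroup.of 0)) : PiTpχ p)
        ((ThetaSetting.modelχ p).inflTheta (ThetaSetting.modelχ p).GtpYdd
            ((kummerDataχSec p).kumYdd ((kummerDataχSec p).toKddHat c)) *
          (ThetaSetting.modelχ p).inflTheta (ThetaSetting.modelχ p).GtpYdd (kummerDataχSec p).logUdd) =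
      (ThetaSetting.modelχ p).inflTheta (ThetaSetting.modelχ p).GtpYdd
          ((kummerDataχSec p).kumYdd ((kummerDataχSec p).toKddHat c)) *
        (ThetaSetting.modelχ p).inflTheta (ThetaSetting.modelχ p).GtpYdd (kummerDataχSec p).logUdd := by
  haveI := hC.GtpYdd_normal
  rw [map_mul, conj_inflTheta_kumYdd_modelχ p hC, conj_genA_inflTheta_logUdd p hC]

/-- Hence its `η̈^{Θ,Z}`-orbit at `MuTwoSetting.modelχ` (`ε_Z := a`) is the singleton. [cite: MochizukiEtTh2009, Def 1.9 p.29] -/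
theorem thetaOrbit_testClass (hC : (ThetaSetting.modelχ p).Compat) (c : (↥(ThetaSetting.modelχ p).Kdd)ˣ) :
    (MuTwoSetting.modelχ p).thetaOrbit hC (epsZχ p)
        ((ThetaSetting.modelχ p).inflTheta (ThetaSetting.modelχ p).GtpYdd
            ((kummerDataχSec p).kumYdd ((kummerDataχSec p).toKddHat c)) *
          (ThetaSetting.modelχ p).inflTheta (ThetaSetting.modelχ p).GtpYdd (kummerDataχSec p).logUdd) =
      {(ThetaSetting.modelχ p).inflTheta (ThetaSetting.modelχ p).GtpYdd
            ((kummerDataχSec p).kumYdd ((kummerDataχSec p).toKddHat c)) *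
          (ThetaSetting.modelχ p).inflTheta (ThetaSetting.modelχ p).GtpYdd (kummerDataχSec p).logUdd} :=
  thetaOrbit_modelχ_eq_singleton p hC (conj_genA_testClass p hC c)

/-- **The value of the test class at an anchored section-point of parameter `w` is `c · w`** (evaluation is a
homomorphism; `κ̈(c)|_y ↦ c` by the Kummer retraction; `log(Ü)|_y ↦ w` by the anchor).
[cite: MochizukiEtTh2009, Prop 1.4 (iii) p.22] -/
theorem evalAt_testClass (A : ThetaSetting.AnchoredPoint (kummerDataχSec p)) (c : (↥(ThetaSetting.modelχ p).Kdd)ˣ) :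
    A.evalAt (ContH1.res (ThetaSetting.modelχ p).toTheta (ThetaSetting.modelχ p).DeltaTheta A.Dpt_le
        ((ThetaSetting.modelχ p).inflTheta (ThetaSetting.modelχ p).GtpYdd
            ((kummerDataχSec p).kumYdd ((kummerDataχSec p).toKddHat c)) *
          (ThetaSetting.modelχ p).inflTheta (ThetaSetting.modelχ p).GtpYdd (kummerDataχSec p).logUdd)) =
      (kummerDataχSec p).toKddHat (c * A.coord) := by
  rw [map_mul, map_mul, A.evalAt_kum, A.evalAt_logUdd, map_mul]

end Literature.AnabelianGeometry.EtaleTheta.SettingModel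

end
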